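import Literature.MathematicalPhysics.QuantumLattice.FreeFermionSlaterModes
import Literature.MathematicalPhysics.QuantumLattice.FermionQuasiFree
import HarnessLib

/-!
# Löwdin's rules: matrix elements between NON-ORTHOGONAL Slater determinants

Topic `Literature/MathematicalPhysics/QuantumLattice`, family `hubbard`; namespace
`Literature.MathematicalPhysics.QuantumLattice.SlaterKernel`. Everything is PROVED; no definition and
no named fact is introduced.

On the tree's Jordan–Wigner Fock space `Fock ι = Finset ι → ℂ` the Slater determinant built from the
columns `h e_t, t ∈ T` of a one-body matrix `h : Matrix ι ι ℂ` is the column `Γ(h)|T⟩ = (Gamma h).col T`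
of the second-quantisation functor (`FermionGammaFunctor`: `Γ(h)|t₁<⋯<t_N⟩ = c†(h e_{t₁}) ⋯ c†(h e_{t_N})|∅⟩`).
For two such determinants `Φ_g = Γ(g)|T⟩`, `Φ_h = Γ(h)|T⟩` (same reference set `T`, `|T| = N`, arbitrary —
in particular mutually NON-orthogonal and non-orthonormal — orbitals) write

* `M = (gᴴ h)[T,T]`       — the `N × N` OVERLAP MATRIX `M_{st} = ⟨g e_s, h e_t⟩` of the orbitals,
* `X_A = (gᴴ A h)[T,T]`   — the matrix `⟨g e_s, A h e_t⟩` of a one-body operator `A` between them.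

The generalized Slater–Condon ("Löwdin") rules, as printed in Avery–Avery, *Generalized Sturmians and
Atomic Spectra* (2006), App. B, and — in the second-quantised / Green's-function form used by lattice
QMC and by projected Hartree–Fock — in Gubernatis–Kawashima–Werner (2016) App. H–I and
Rodríguez-Guzmán et al. (2012) App. A, become the following theorems:

* §2 `star_col_Gamma_dotProduct_col_Gamma(_eq_det)` — **overlap rule** `⟨Φ_g, Φ_h⟩ = det M`
  [AveryAvery2006 (B.6)–(B.7); GubernatisKawashimaWerner2016 (H.4); Löwdin 1955];
* §3 `dGamma_mulVec_col_Gamma` — Leibniz rule `dΓ(A) Γ(h)|T⟩ = Σ_{t∈T} Γ(h[t ← A h e_t])|T⟩`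
  (a one-body operator acts on a determinant column by column);
* §4 `kernel_dGamma_eq_trace_adjugate` — **one-body rule** `⟨Φ_g, dΓ(A) Φ_h⟩ = tr(adj M · X_A)`
  `= Σ_{ij} (−1)^{i+j} ⟨g e_i, A h e_j⟩ |M_{ij}|` [AveryAvery2006 (B.14)], its inverse form
  `det M · tr(M⁻¹ X_A)` and the entry form `⟨Φ_g, c†_p c_q Φ_h⟩ = (h_T adj(M) g_Tᴴ)_{qp}` — the
  TRANSITION DENSITY MATRIX `ρ = h_T M⁻¹ g_Tᴴ` [GubernatisKawashimaWerner2016 (I.2);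
  RodriguezGuzmanEtAl2012 App. A];
* §5 `kernel_dGamma_dGamma_eq` — **two-body rule / generalized Wick theorem for a determinant pair**:
  `⟨Φ_g, dΓ(A) dΓ(B) Φ_h⟩ = det M · (tr(M⁻¹X_{AB}) + tr(M⁻¹X_A) tr(M⁻¹X_B) − tr(M⁻¹X_A M⁻¹X_B))`
  (contraction + direct − exchange) for invertible `M`, and the determinant (second-order cofactor)
  form valid for every `M` [AveryAvery2006 (B.19); GubernatisKawashimaWerner2016 §7.2.4];
* §6 `hubbard_kernel_eq` — the **Hubbard energy kernel** between two determinants,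
  `⟨Φ_g, H Φ_h⟩ = det M · (tr(K ρ) + U Σ_x (ρ_{x↑,x↑} ρ_{x↓,x↓} − ρ_{x↑,x↓} ρ_{x↓,x↑}))`,
  `K` the hopping matrix, `ρ = h_T M⁻¹ g_Tᴴ` [RodriguezGuzmanEtAl2012 App. A: `n^{ik} = det 𝒳^{ik}`,
  `h^{ik} = ½ t^{ik} + ½ Tr(Γ^{ik} ρ^{ki})`, `ρ^{ki} = 𝒮 𝒟^{k*} (𝒳^{ik})⁻¹ 𝒟^{iT}`], and the insertion of
  any one-body symmetry `Γ(u)` (`Γ(u) Φ_h = Φ_{uh}`, §1).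

These are exactly the formulas evaluated (in exact rational arithmetic, by two independent programs) by
symmetry-projected (multi-)determinant upper-bound certificates for the Hubbard model: with this file
the `sphf`/`FED` certificate kind of the many-body-bootstrap cell is kernel-checked down to arithmetic
on explicit integer matrices (spin projection: `LowdinSpinProjection`; variational bound:
`SymmetryProjectedVariationalBound`).

## Proof sketch

§2 is functoriality `Γ(gᴴ)Γ(h) = Γ(gᴴh)` read at one matrix entry. §3 is the commutator
`[dΓ(A), c†(f)] = c†(Af)` (`dGamma_mul_create_sub`) pushed through the creation recursion
`Γ(h)|T⟩ = c†(h e_{min T}) Γ(h)|T ∖ min T⟩` (`col_Gamma_eq_create_mulVec`), together with the remark that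
`Γ(h)|T⟩` only depends on the columns of `h` indexed by `T`. §4: by §3 and §2 the kernel is a sum of
determinants of `M` with one column replaced, i.e. Cramer / the adjugate. §5: §3 twice gives determinants
with two columns replaced; for invertible `M` these are `det M` times `2 × 2` determinants
(`Matrix.det_one_add_mul_comm`), whose sum reorganises into traces. §6 specialises to
`H = dΓ(K) + U Σ_x dΓ(E_{x↑}) dΓ(E_{x↓})` with rank-one `X_{E}`.

## Mathlib / tree search

Tree (REUSED): `Gamma`, `Gamma_apply_of_card_eq/_ne`, `col_Gamma_empty`, `col_Gamma_eq_create_mulVec`,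
`Gamma_mul`, `Gamma_conjTranspose` (`FermionGammaFunctor`); `dGamma`, `dGamma_eq` (`FermionQuasiFree`);
`dGamma_mul_create_sub` (`FreeFermionSlaterModes`); `dGamma_mulVec_vacuum` (`FermionGammaFunctorTrace`);
`create`, `create_add` (`HubbardWave0RayleighProofs`/`FreeFermionSlaterModes`); `hamiltonian`, `numberOp`,
`hubbardOneBody`, `hamiltonianWith_zero_eq_dGamma`. Mathlib: `Matrix.cramer_apply`,
`Matrix.cramer_eq_adjugate_mulVec`, `Matrix.det_one_add_mul_comm`, `Matrix.det_fin_two_of`,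
`Matrix.nonsing_inv_apply`, `Matrix.trace_mul_comm`. Nothing on non-orthogonal determinant pairs exists in
Mathlib or in the tree (`HartreeFockGramProjector` treats the density matrix of ONE determinant through the
Gram projector; `QuantumComplexity.SlaterState` is a different vocabulary and has only the norm).

## References

* P.-O. Löwdin, *Quantum theory of many-particle systems. I*, Phys. Rev. 97 (1955) 1474 (original
  statement of the three rules with cofactors of the overlap determinant). [Lowdin1955QTMPS1]
* J. Avery, J. Avery, *Generalized Sturmians and Atomic Spectra* (World Scientific 2006), Appendix B
  "Generalized Slater–Condon rules", eqs. (B.6)–(B.7), (B.14), (B.19)–(B.20). [AveryAvery2006]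
* J. Gubernatis, N. Kawashima, P. Werner, *Quantum Monte Carlo Methods: Algorithms for Lattice Models*
  (CUP 2016), App. H eq. (H.4), App. I eq. (I.2), §7.2.4. [GubernatisKawashimaWerner2016]
* R. Rodríguez-Guzmán, K. W. Schmid, C. A. Jiménez-Hoyos, G. E. Scuseria, Phys. Rev. B 85 (2012) 245130,
  Appendix A. [RodriguezGuzmanEtAl2012]
-/

noncomputable section

namespace Literature.MathematicalPhysics.QuantumLattice

namespace SlaterKernel

open Matrix Finset RayleighBound

variable {ι : Type*} [LinearOrder ι] [Fintype ι]

/-! ### §1. Slater determinants as columns of `Γ`; column congruence; symmetry insertion -/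

omit [Fintype ι] in
/-- `Γ(h)|T⟩` only depends on the columns of `h` indexed by `T` (the determinant is built from the
orbitals `h e_t, t ∈ T`: the entries of `Γ(h)` are the minors `det h[S,T]`).
[cite: DerezinskiGerard2022, §3.3.3 Def. 3.34] -/
theorem col_Gamma_congr {g h : Matrix ι ι ℂ} {T : Finset ι} (hgh : ∀ i, ∀ t ∈ T, g i t = h i t) :
    (Gamma g).col T = (Gamma h).col T := by
  funext S
  rw [col_apply, col_apply]
  by_cases hST : S.card = T.card
  · rw [Gamma_apply_of_card_eq g hST rfl, Gamma_apply_of_card_eq h hST rfl]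
    congr 1
    ext i j
    simp only [submatrix_apply]
    exact hgh _ _ (Finset.orderEmbOfFin_mem T rfl j)
  · rw [Gamma_apply_of_card_ne g hST, Gamma_apply_of_card_ne h hST]

/-- **Symmetry insertion / Thouless form**: a second-quantised one-body operator maps a Slater
determinant to the Slater determinant of the transformed orbitals, `Γ(u) Γ(h)|T⟩ = Γ(u h)|T⟩`
(functoriality `Γ(uh) = Γ(u)Γ(h)` read on a column). [cite: GubernatisKawashimaWerner2016, App. F] -/
theorem Gamma_mulVec_col_Gamma (u h : Matrix ι ι ℂ) (T : Finset ι) :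
    Gamma u *ᵥ (Gamma h).col T = (Gamma (u * h)).col T := by
  rw [← mulVec_single_one, ← mulVec_single_one, mulVec_mulVec, Gamma_mul]

/-! ### §2. The overlap rule `⟨Φ_g, Φ_h⟩ = det (gᴴ h)[T,T]` -/

omit [LinearOrder ι] [Fintype ι] in
/-- `⟨A e_S, v⟩ = (Aᴴ v)_S` on the Fock space. [folklore] -/
private theorem star_col_dotProduct {κ : Type*} [Fintype κ] (A : Matrix κ κ ℂ) (S : κ) (v : κ → ℂ) :
    star (A.col S) ⬝ᵥ v = (Aᴴ *ᵥ v) S := by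
  simp only [dotProduct, mulVec, conjTranspose_apply, col_apply, Pi.star_apply]

/-- **Löwdin's overlap rule, matrix form**: `⟨Γ(g)|S⟩, Γ(h)|T⟩⟩ = ⟨S| Γ(gᴴ h) |T⟩`, i.e. the overlap of
the two Slater determinants is the corresponding minor of the one-body product `gᴴ h` — whose entries
`(gᴴ h)_{st} = ⟨g e_s, h e_t⟩` are the overlaps of the orbitals.
[cite: AveryAvery2006, App. B eq. (B.6)–(B.7)] [cite: GubernatisKawashimaWerner2016, App. H eq. (H.4)] -/
theorem star_col_Gamma_dotProduct_col_Gamma (g h : Matrix ι ι ℂ) (S T : Finset ι) :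
    star ((Gamma g).col S) ⬝ᵥ ((Gamma h).col T) = Gamma (gᴴ * h) S T := by
  rw [star_col_dotProduct, ← Gamma_conjTranspose, Gamma_mulVec_col_Gamma, col_apply]

/-- **Löwdin's overlap rule** `⟨Φ_g, Φ_h⟩ = det M` with `M = (gᴴ h)[S,T]` the `k × k` overlap matrix of
the orbitals (`|S| = |T| = k`; for `|S| ≠ |T|` the overlap vanishes, `Gamma_apply_of_card_ne`).
[cite: AveryAvery2006, App. B eq. (B.6)–(B.7)] [cite: GubernatisKawashimaWerner2016, App. H eq. (H.4)]
[cite: Lowdin1955QTMPS1] -/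
theorem star_col_Gamma_dotProduct_col_Gamma_eq_det (g h : Matrix ι ι ℂ) {S T : Finset ι} {k : ℕ}
    (hS : S.card = k) (hT : T.card = k) :
    star ((Gamma g).col S) ⬝ᵥ ((Gamma h).col T) =
      ((gᴴ * h).submatrix (S.orderEmbOfFin hS) (T.orderEmbOfFin hT)).det := by
  rw [star_col_Gamma_dotProduct_col_Gamma, Gamma_apply_of_card_eq _ hS hT]

omit [LinearOrder ι] in
/-- The entries of `gᴴ h` are the orbital overlaps `⟨g e_s, h e_t⟩`. [folklore] -/
private theorem conjTranspose_mul_apply_eq_dotProduct (g h : Matrix ι ι ℂ) (s t : ι) :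
    (gᴴ * h) s t = star (g.col s) ⬝ᵥ h.col t := by
  simp only [mul_apply, conjTranspose_apply, dotProduct, col_apply, Pi.star_apply]

/-! ### §3. Leibniz rule: a one-body operator acts on a determinant column by column -/

/-- `dΓ(A) c†(f) = c†(A f) + c†(f) dΓ(A)`. [cite: BratteliRobinsonII1997, §5.2.1] -/
theorem dGamma_mul_create (A : Matrix ι ι ℂ) (f : ι → ℂ) :
    dGamma A * create f = create (A *ᵥ f) + create f * dGamma A := by
  rw [← dGamma_mul_create_sub]; abel

omit [Fintype ι] in
/-- Replacing column `t` does not change the other columns. [folklore] -/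
private theorem updateCol_col_of_ne (h : Matrix ι ι ℂ) {t t' : ι} (c : ι → ℂ) (htt' : t' ≠ t) :
    (h.updateCol t c).col t' = h.col t' := by
  funext i; rw [col_apply, col_apply, updateCol_ne htt']

omit [Fintype ι] in
/-- The replaced column. [folklore] -/
private theorem updateCol_col_self (h : Matrix ι ι ℂ) (t : ι) (c : ι → ℂ) : (h.updateCol t c).col t = c := by
  funext i; rw [col_apply, updateCol_self]

omit [LinearOrder ι] [Fintype ι] in
/-- `(A h) e_t = A (h e_t)`. [folklore] -/
private theorem col_mul {κ : Type*} [Fintype κ] (A : Matrix ι κ ℂ) (h : Matrix κ ι ℂ) (t : ι) :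
    (A * h).col t = A *ᵥ h.col t := by
  funext i; simp only [col_apply, mul_apply, mulVec, dotProduct]

/-- **Leibniz rule.** A second-quantised one-body operator acts on a Slater determinant as a
derivation, one orbital at a time: `dΓ(A) Γ(h)|T⟩ = Σ_{t ∈ T} Γ(h[t ← A h e_t])|T⟩`, where
`h[t ← A h e_t] = h.updateCol t ((A h) e_t)` is `h` with its `t`-th column replaced by `A` applied to
it. [cite: AveryAvery2006, App. B eq. (B.9)–(B.12)] [cite: BratteliRobinsonII1997, §5.2.1] -/
theorem dGamma_mulVec_col_Gamma (A h : Matrix ι ι ℂ) (T : Finset ι) :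
    dGamma A *ᵥ (Gamma h).col T = ∑ t ∈ T, (Gamma (h.updateCol t ((A * h).col t))).col T := by
  suffices H : ∀ (n : ℕ) (h : Matrix ι ι ℂ) (T : Finset ι), T.card = n →
      dGamma A *ᵥ (Gamma h).col T = ∑ t ∈ T, (Gamma (h.updateCol t ((A * h).col t))).col T from
    H T.card h T rfl
  intro n
  induction n with
  | zero =>
    intro h T hT
    rw [card_eq_zero] at hT
    subst hT
    rw [sum_empty, col_Gamma_empty, dGamma_mulVec_vacuum]
  | succ n ih =>
    intro h T hT
    have hne : T.Nonempty := card_pos.mp (by omega)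
    set t₀ := T.min' hne with ht₀
    have ht₀T : t₀ ∈ T := min'_mem T hne
    have hcard : (T.erase t₀).card = n := by rw [card_erase_of_mem ht₀T, hT]; rfl
    -- peel off the lowest orbital and commute `dΓ(A)` through its creation operator
    rw [col_Gamma_eq_create_mulVec h hne, ← ht₀, mulVec_mulVec, dGamma_mul_create, add_mulVec,
      ← mulVec_mulVec, ih h (T.erase t₀) hcard, ← add_sum_erase T _ ht₀T]
    congr 1
    · -- the term `t = t₀`: the new column `A h e_{t₀}` is created on top of the unchanged rest
      rw [col_Gamma_eq_create_mulVec (h.updateCol t₀ ((A * h).col t₀)) hne, ← ht₀]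
      congr 1
      · congr 1
        funext i
        simp only [updateCol_self, col_apply, mul_apply, mulVec, dotProduct]
      · exact col_Gamma_congr fun i t' ht' => (updateCol_ne (ne_of_mem_erase ht')).symm
    · -- the terms `t ≠ t₀`: column `t₀` is untouched
      rw [mulVec_sum]
      refine sum_congr rfl fun t ht => ?_
      have htt₀ : t₀ ≠ t := fun h' => (ne_of_mem_erase ht) h'.symm
      rw [col_Gamma_eq_create_mulVec (h.updateCol t ((A * h).col t)) hne, ← ht₀]
      congr 2
      funext i
      exact (updateCol_ne htt₀).symm

/-- The kernel of a one-body operator between two Slater determinants as a sum of overlap minors with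
one column replaced: `⟨Γ(g)|S⟩, dΓ(A) Γ(h)|T⟩⟩ = Σ_{t∈T} ⟨S|Γ(gᴴ · h[t ← A h e_t])|T⟩`.
[cite: AveryAvery2006, App. B eq. (B.12)] -/
theorem kernel_dGamma_eq_sum (g A h : Matrix ι ι ℂ) (S T : Finset ι) :
    star ((Gamma g).col S) ⬝ᵥ (dGamma A *ᵥ (Gamma h).col T) =
      ∑ t ∈ T, Gamma (gᴴ * h.updateCol t ((A * h).col t)) S T := by
  rw [dGamma_mulVec_col_Gamma, dotProduct_sum]
  exact sum_congr rfl fun t _ => star_col_Gamma_dotProduct_col_Gamma g _ S T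

/-! ### §4. The one-body rule: first-order cofactors of the overlap matrix, transition density -/

/-- Left multiplication commutes with replacing a column: `N · h[t ← c] = (N h)[t ← N c]`. [folklore] -/
private theorem mul_updateCol {κ : Type*} (N : Matrix κ ι ℂ) (h : Matrix ι ι ℂ) (t : ι) (c : ι → ℂ) :
    N * h.updateCol t c = (N * h).updateCol t (N *ᵥ c) := by
  ext i j
  by_cases hj : j = t
  · subst hj
    simp only [mul_apply, updateCol_self, mulVec, dotProduct]
  · simp only [mul_apply, updateCol_ne hj]

omit [Fintype ι] in
/-- Restricting a column replacement along an injective re-indexing `e` with `e j = t`. [folklore] -/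
private theorem submatrix_updateCol {k : ℕ} (P : Matrix ι ι ℂ) {e : Fin k → ι} (he : Function.Injective e)
    (j : Fin k) (d : ι → ℂ) :
    (P.updateCol (e j) d).submatrix e e = (P.submatrix e e).updateCol j (d ∘ e) := by
  ext a b
  by_cases hb : b = j
  · subst hb
    simp only [submatrix_apply, updateCol_self, Function.comp_apply]
  · have hb' : e b ≠ e j := fun h => hb (he h)
    simp only [submatrix_apply, updateCol_ne hb, updateCol_ne hb']

omit [Fintype ι] in
/-- Re-indexing a sum over `T` by its increasing enumeration. [folklore] -/
private theorem sum_eq_sum_orderEmbOfFin {β : Type*} [AddCommMonoid β] (T : Finset ι) {k : ℕ} (hT : T.card = k)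
    (f : ι → β) : ∑ t ∈ T, f t = ∑ j : Fin k, f (T.orderEmbOfFin hT j) := by
  rw [← sum_coe_sort, ← (T.orderIsoOfFin hT).sum_comp]
  rfl

omit [LinearOrder ι] [Fintype ι] in
/-- **Cramer / first-order cofactors**: the sum of the determinants of `M` with its `j`-th column replaced
by the `j`-th column of `X` is `tr(adj M · X) = Σ_{ij} (−1)^{i+j} X_{ij} |M_{ij}|`.
[cite: AveryAvery2006, App. B eq. (B.14)] -/
theorem sum_det_updateCol_eq_trace_adjugate_mul {k : ℕ} (M X : Matrix (Fin k) (Fin k) ℂ) :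
    ∑ j, (M.updateCol j (X.col j)).det = (M.adjugate * X).trace := by
  simp only [Matrix.trace, diag_apply, mul_apply]
  refine sum_congr rfl fun j _ => ?_
  rw [← cramer_apply, cramer_eq_adjugate_mulVec]
  simp only [mulVec, dotProduct, col_apply]

/-- **Löwdin's one-body rule (first-order cofactor form).** For two Slater determinants
`Φ_g = Γ(g)|T⟩`, `Φ_h = Γ(h)|T⟩` on the same `k`-set `T` (increasing enumeration `e`), overlap matrix
`M = (gᴴ h)[T,T]` and one-body matrix `X_A = (gᴴ A h)[T,T]` (entries `⟨g e_s, A h e_t⟩`):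
`⟨Φ_g, dΓ(A) Φ_h⟩ = tr(adj M · X_A) = Σ_{ij} (−1)^{i+j} ⟨g e_i, A h e_j⟩ |M_{ij}|`. No orthogonality and no
invertibility is assumed. [cite: AveryAvery2006, App. B eq. (B.14)] [cite: Lowdin1955QTMPS1] -/
theorem kernel_dGamma_eq_trace_adjugate (g A h : Matrix ι ι ℂ) {T : Finset ι} {k : ℕ} (hT : T.card = k) :
    star ((Gamma g).col T) ⬝ᵥ (dGamma A *ᵥ (Gamma h).col T) =
      (((gᴴ * h).submatrix (T.orderEmbOfFin hT) (T.orderEmbOfFin hT)).adjugate *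
        (gᴴ * (A * h)).submatrix (T.orderEmbOfFin hT) (T.orderEmbOfFin hT)).trace := by
  set e := T.orderEmbOfFin hT with he
  rw [kernel_dGamma_eq_sum, sum_eq_sum_orderEmbOfFin T hT, ← he,
    ← sum_det_updateCol_eq_trace_adjugate_mul]
  refine sum_congr rfl fun j _ => ?_
  rw [Gamma_apply_of_card_eq _ hT hT, ← he, mul_updateCol, submatrix_updateCol _ e.injective j]
  congr 2

/-- The adjugate of an invertible matrix is `det M · M⁻¹`. [folklore] -/
private theorem adjugate_eq_det_smul_inv {k : ℕ} {M : Matrix (Fin k) (Fin k) ℂ} (hM : IsUnit M.det) :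
    M.adjugate = M.det • M⁻¹ := by
  rw [Matrix.inv_def, smul_smul, Ring.mul_inverse_cancel _ hM, one_smul]

/-- **Löwdin's one-body rule, inverse (transition-density) form**: for an invertible overlap matrix,
`⟨Φ_g, dΓ(A) Φ_h⟩ = det M · tr(M⁻¹ X_A)`.
[cite: GubernatisKawashimaWerner2016, App. I eq. (I.2)] [cite: RodriguezGuzmanEtAl2012, App. A] -/
theorem kernel_dGamma_eq_det_mul_trace_inv (g A h : Matrix ι ι ℂ) {T : Finset ι} {k : ℕ} (hT : T.card = k)
    (hM : IsUnit ((gᴴ * h).submatrix (T.orderEmbOfFin hT) (T.orderEmbOfFin hT)).det) :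
    star ((Gamma g).col T) ⬝ᵥ (dGamma A *ᵥ (Gamma h).col T) =
      ((gᴴ * h).submatrix (T.orderEmbOfFin hT) (T.orderEmbOfFin hT)).det *
        (((gᴴ * h).submatrix (T.orderEmbOfFin hT) (T.orderEmbOfFin hT))⁻¹ *
          (gᴴ * (A * h)).submatrix (T.orderEmbOfFin hT) (T.orderEmbOfFin hT)).trace := by
  rw [kernel_dGamma_eq_trace_adjugate, adjugate_eq_det_smul_inv hM, smul_mul, trace_smul, smul_eq_mul]

/-- `dΓ` of a matrix unit is the corresponding bilinear: `dΓ(c E_{pq}) = c c†_p c_q`.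
[cite: BratteliRobinsonII1997, §5.2.1] -/
theorem dGamma_single (p q : ι) (c : ℂ) :
    dGamma (Matrix.single p q c) = c • (creation p * annihilation q) := by
  rw [dGamma_eq, sum_eq_single p, sum_eq_single q]
  · rw [Matrix.single_apply_same]
  · intro j _ hj; rw [Matrix.single_apply_of_col_ne _ _ (Ne.symm hj), zero_smul]
  · intro h; exact absurd (mem_univ q) h
  · intro i _ hi
    refine sum_eq_zero fun j _ => ?_
    rw [Matrix.single_apply_of_row_ne (Ne.symm hi), zero_smul]
  · intro h; exact absurd (mem_univ p) h

/-- Entries of `gᴴ E_{pq} h`: `(gᴴ E_{pq} h)_{ab} = conj(g_{pa}) h_{qb}` (rank one). [folklore] -/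
private theorem conjTranspose_mul_single_mul_apply (g h : Matrix ι ι ℂ) (p q a b : ι) :
    (gᴴ * (Matrix.single p q (1 : ℂ) * h)) a b = star (g p a) * h q b := by
  rw [mul_apply, sum_eq_single p]
  · rw [conjTranspose_apply, Matrix.single_mul_apply_same, one_mul]
  · intro m _ hm
    rw [Matrix.single_mul_apply_of_ne (h := hm), mul_zero]
  · intro h; exact absurd (mem_univ p) h

/-- **The transition density matrix (cofactor form).** The one-particle transition matrix element between
two Slater determinants is an entry of `ρ̃ = h_T · adj M · g_Tᴴ` (`h_T`, `g_T` the `ι × k` orbital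
matrices): `⟨Φ_g, c†_p c_q Φ_h⟩ = (h_T adj(M) g_Tᴴ)_{qp}`; for invertible `M` this is `det M · ρ_{qp}` with
the transition density matrix `ρ = h_T M⁻¹ g_Tᴴ` (Green's function `G = 1 − ρᵀ` of the zero-temperature
determinant method). [cite: GubernatisKawashimaWerner2016, App. I eq. (I.2)]
[cite: RodriguezGuzmanEtAl2012, App. A] [cite: AveryAvery2006, App. B eq. (B.14)] -/
theorem kernel_creation_mul_annihilation_eq (g h : Matrix ι ι ℂ) {T : Finset ι} {k : ℕ} (hT : T.card = k)
    (p q : ι) :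
    star ((Gamma g).col T) ⬝ᵥ ((creation p * annihilation q) *ᵥ (Gamma h).col T) =
      (h.submatrix id (T.orderEmbOfFin hT) *
          ((gᴴ * h).submatrix (T.orderEmbOfFin hT) (T.orderEmbOfFin hT)).adjugate *
        (g.submatrix id (T.orderEmbOfFin hT))ᴴ) q p := by
  have h1 : creation p * annihilation q = dGamma (Matrix.single p q (1 : ℂ)) := by
    rw [dGamma_single, one_smul]
  rw [h1, kernel_dGamma_eq_trace_adjugate g _ h hT]
  set e := T.orderEmbOfFin hT
  have hX : (gᴴ * (Matrix.single p q (1 : ℂ) * h)).submatrix e e =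
      Matrix.of fun i j => star (g p (e i)) * h q (e j) := by
    ext i j
    rw [submatrix_apply, conjTranspose_mul_single_mul_apply, of_apply]
  rw [hX]
  simp only [Matrix.trace, diag_apply, mul_apply, of_apply, submatrix_apply, conjTranspose_apply, id_eq,
    sum_mul]
  rw [sum_comm]
  refine sum_congr rfl fun i _ => sum_congr rfl fun j _ => ?_
  ring

/-! ### §5. The two-body rule: second-order cofactors / generalized Wick theorem for a determinant pair -/

omit [Fintype ι] in
/-- Replacing the same column twice keeps the last replacement. [folklore] -/
private theorem updateCol_updateCol_self (h : Matrix ι ι ℂ) (t : ι) (c d : ι → ℂ) :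
    (h.updateCol t c).updateCol t d = h.updateCol t d := by
  ext i j
  by_cases hj : j = t
  · subst hj; rw [updateCol_self, updateCol_self]
  · rw [updateCol_ne hj, updateCol_ne hj, updateCol_ne hj]

/-- **Leibniz rule, applied twice.** `dΓ(A) dΓ(B) Γ(h)|T⟩` is the sum of the determinants in which ONE
orbital `h e_t` is replaced by `A B h e_t` (the contraction of `c_q c†_r` in `c†_p c_q c†_r c_s`) and of
those in which TWO distinct orbitals `h e_t`, `h e_{t'}` are replaced by `B h e_t` and `A h e_{t'}`.
[cite: AveryAvery2006, App. B eq. (B.16)–(B.18)] -/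
theorem dGamma_dGamma_mulVec_col_Gamma (A B h : Matrix ι ι ℂ) (T : Finset ι) :
    dGamma A *ᵥ (dGamma B *ᵥ (Gamma h).col T) =
      ∑ t ∈ T, (Gamma (h.updateCol t ((A * B * h).col t))).col T +
        ∑ t ∈ T, ∑ t' ∈ T.erase t,
          (Gamma ((h.updateCol t ((B * h).col t)).updateCol t' ((A * h).col t'))).col T := by
  rw [dGamma_mulVec_col_Gamma, mulVec_sum, ← sum_add_distrib]
  refine sum_congr rfl fun t ht => ?_
  rw [dGamma_mulVec_col_Gamma, ← add_sum_erase T _ ht]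
  congr 1
  · rw [updateCol_updateCol_self, col_mul A (h.updateCol t ((B * h).col t)) t, updateCol_col_self,
      col_mul B h t, mulVec_mulVec, ← col_mul (A * B) h t]
  · refine sum_congr rfl fun t' ht' => ?_
    rw [col_mul A (h.updateCol t ((B * h).col t)) t', updateCol_col_of_ne _ _ (ne_of_mem_erase ht'),
      ← col_mul A h t']

/-- The two-body kernel as a sum of overlap minors with one or two columns replaced.
[cite: AveryAvery2006, App. B eq. (B.16)–(B.19)] -/
theorem kernel_dGamma_dGamma_eq_sum (g A B h : Matrix ι ι ℂ) (S T : Finset ι) :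
    star ((Gamma g).col S) ⬝ᵥ (dGamma A *ᵥ (dGamma B *ᵥ (Gamma h).col T)) =
      ∑ t ∈ T, Gamma (gᴴ * h.updateCol t ((A * B * h).col t)) S T +
        ∑ t ∈ T, ∑ t' ∈ T.erase t,
          Gamma (gᴴ * (h.updateCol t ((B * h).col t)).updateCol t' ((A * h).col t')) S T := by
  rw [dGamma_dGamma_mulVec_col_Gamma, dotProduct_add, dotProduct_sum, dotProduct_sum]
  congr 1
  · exact sum_congr rfl fun t _ => star_col_Gamma_dotProduct_col_Gamma g _ S T
  · refine sum_congr rfl fun t _ => ?_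
    rw [dotProduct_sum]
    exact sum_congr rfl fun t' _ => star_col_Gamma_dotProduct_col_Gamma g _ S T

omit [Fintype ι] in
/-- A sum over `T ∖ {e j}` re-indexed by the increasing enumeration `e` of `T`. [folklore] -/
private theorem sum_erase_eq_sum_orderEmbOfFin {β : Type*} [AddCommGroup β] (T : Finset ι) {k : ℕ}
    (hT : T.card = k) (j : Fin k) (f : ι → β) :
    ∑ t ∈ T.erase (T.orderEmbOfFin hT j), f t = ∑ j' ∈ univ.erase j, f (T.orderEmbOfFin hT j') := by
  rw [sum_erase_eq_sub (Finset.orderEmbOfFin_mem T hT j), sum_erase_eq_sub (mem_univ j),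
    sum_eq_sum_orderEmbOfFin T hT]

/-- **The two-body rule, determinant form** (valid for EVERY overlap matrix): with
`M = (gᴴ h)[T,T]`, `X = (gᴴ A h)[T,T]`, `Y = (gᴴ B h)[T,T]`, `Z = (gᴴ A B h)[T,T]`,
`⟨Φ_g, dΓ(A) dΓ(B) Φ_h⟩ = tr(adj M · Z) + Σ_{j ≠ j'} det M[j ← Y e_j, j' ← X e_{j'}]`
(the determinants with two columns replaced are the second-order cofactor terms `Σ (−1)^{…} |M_{ij;kl}|`).
[cite: AveryAvery2006, App. B eq. (B.19)] [cite: Lowdin1955QTMPS1] -/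
theorem kernel_dGamma_dGamma_eq_det (g A B h : Matrix ι ι ℂ) {T : Finset ι} {k : ℕ} (hT : T.card = k) :
    star ((Gamma g).col T) ⬝ᵥ (dGamma A *ᵥ (dGamma B *ᵥ (Gamma h).col T)) =
      (((gᴴ * h).submatrix (T.orderEmbOfFin hT) (T.orderEmbOfFin hT)).adjugate *
          (gᴴ * (A * B * h)).submatrix (T.orderEmbOfFin hT) (T.orderEmbOfFin hT)).trace +
        ∑ j, ∑ j' ∈ univ.erase j,
          ((((gᴴ * h).submatrix (T.orderEmbOfFin hT) (T.orderEmbOfFin hT)).updateCol j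
              (((gᴴ * (B * h)).submatrix (T.orderEmbOfFin hT) (T.orderEmbOfFin hT)).col j)).updateCol j'
              (((gᴴ * (A * h)).submatrix (T.orderEmbOfFin hT) (T.orderEmbOfFin hT)).col j')).det := by
  set e := T.orderEmbOfFin hT with he
  rw [kernel_dGamma_dGamma_eq_sum, sum_eq_sum_orderEmbOfFin T hT, ← he,
    ← sum_det_updateCol_eq_trace_adjugate_mul, sum_eq_sum_orderEmbOfFin T hT, ← he]
  congr 1
  · refine sum_congr rfl fun j _ => ?_
    rw [Gamma_apply_of_card_eq _ hT hT, ← he, mul_updateCol, submatrix_updateCol _ e.injective j]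
    congr 2
  · refine sum_congr rfl fun j _ => ?_
    rw [he, sum_erase_eq_sum_orderEmbOfFin T hT, ← he]
    refine sum_congr rfl fun j' _ => ?_
    rw [Gamma_apply_of_card_eq _ hT hT, ← he, mul_updateCol, mul_updateCol,
      submatrix_updateCol _ e.injective j', submatrix_updateCol _ e.injective j]
    congr 2

/-- The identity with two columns replaced: `det 1[j ← b, j' ← a] = b_j a_{j'} − a_j b_{j'}` for
`j ≠ j'` (rank-two update, via `det(1 + UV) = det(1 + VU)`). [folklore] -/
private theorem det_one_updateCol_updateCol {k : ℕ} {j j' : Fin k} (hjj' : j ≠ j') (b a : Fin k → ℂ) :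
    (((1 : Matrix (Fin k) (Fin k) ℂ).updateCol j b).updateCol j' a).det = b j * a j' - a j * b j' := by
  set U : Matrix (Fin k) (Fin 2) ℂ := Matrix.of fun i r =>
    if r = 0 then b i - (1 : Matrix (Fin k) (Fin k) ℂ) i j else a i - (1 : Matrix (Fin k) (Fin k) ℂ) i j'
    with hU
  set V : Matrix (Fin 2) (Fin k) ℂ := Matrix.of fun r l =>
    if r = 0 then (1 : Matrix (Fin k) (Fin k) ℂ) j l else (1 : Matrix (Fin k) (Fin k) ℂ) j' l with hV
  have hUV : ∀ i l, (U * V) i l =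
      (b i - (1 : Matrix (Fin k) (Fin k) ℂ) i j) * (1 : Matrix (Fin k) (Fin k) ℂ) j l +
        (a i - (1 : Matrix (Fin k) (Fin k) ℂ) i j') * (1 : Matrix (Fin k) (Fin k) ℂ) j' l := by
    intro i l
    rw [Matrix.mul_apply, Fin.sum_univ_two]
    simp [hU, hV]
  have hE : ((1 : Matrix (Fin k) (Fin k) ℂ).updateCol j b).updateCol j' a = 1 + U * V := by
    ext i l
    rw [Matrix.add_apply, hUV, updateCol_apply, updateCol_apply]
    simp only [one_apply]
    by_cases h1 : l = j'
    · subst h1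
      simp [hjj']
    · by_cases h2 : l = j
      · subst h2
        simp [h1, Ne.symm h1]
      · simp [h1, h2, Ne.symm h1, Ne.symm h2]
  have hVU : ∀ r s, (V * U) r s = U (if r = 0 then j else j') s := by
    intro r s
    rw [Matrix.mul_apply]
    by_cases hr : r = 0
    · subst hr
      simp [hV, one_apply, ite_mul, Finset.sum_ite_eq]
    · simp [hV, hr, one_apply, ite_mul, Finset.sum_ite_eq]
  rw [hE, det_one_add_mul_comm, Matrix.det_fin_two]
  simp only [Matrix.add_apply, hVU]
  simp [hU, one_apply, hjj', Ne.symm hjj']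

/-- **Determinants with two columns replaced, for an invertible matrix**:
`det M[j ← y, j' ← x] = det M · ((M⁻¹y)_j (M⁻¹x)_{j'} − (M⁻¹x)_j (M⁻¹y)_{j'})` (`j ≠ j'`).
[folklore] -/
private theorem det_updateCol_updateCol {k : ℕ} {M : Matrix (Fin k) (Fin k) ℂ} (hM : IsUnit M.det) {j j' : Fin k}
    (hjj' : j ≠ j') (y x : Fin k → ℂ) :
    ((M.updateCol j y).updateCol j' x).det =
      M.det * ((M⁻¹ *ᵥ y) j * (M⁻¹ *ᵥ x) j' - (M⁻¹ *ᵥ x) j * (M⁻¹ *ᵥ y) j') := by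
  have hE : (M.updateCol j y).updateCol j' x =
      M * (((1 : Matrix (Fin k) (Fin k) ℂ).updateCol j (M⁻¹ *ᵥ y)).updateCol j' (M⁻¹ *ᵥ x)) := by
    rw [mul_updateCol, mul_updateCol, Matrix.mul_one, mulVec_mulVec, mulVec_mulVec, mul_nonsing_inv _ hM,
      one_mulVec, one_mulVec]
  rw [hE, det_mul, det_one_updateCol_updateCol hjj']

/-- `(M⁻¹ (X e_j))_i = (M⁻¹ X)_{ij}`. [folklore] -/
private theorem inv_mulVec_col_apply {k : ℕ} (M X : Matrix (Fin k) (Fin k) ℂ) (i j : Fin k) :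
    (M⁻¹ *ᵥ X.col j) i = (M⁻¹ * X) i j := by
  rw [← col_mul, col_apply]

/-- **Löwdin's two-body rule / the generalized Wick theorem for a pair of non-orthogonal Slater
determinants.** For an invertible overlap matrix `M = (gᴴh)[T,T]` and one-body matrices `A`, `B`, with
`X = (gᴴ A h)[T,T]`, `Y = (gᴴ B h)[T,T]`, `Z = (gᴴ A B h)[T,T]`:
`⟨Φ_g, dΓ(A) dΓ(B) Φ_h⟩ = det M · ( tr(M⁻¹Z) + tr(M⁻¹X) tr(M⁻¹Y) − tr(M⁻¹X M⁻¹Y) )`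
— contraction, direct and exchange terms; with `A = E_{pq}`, `B = E_{rs}` this reads
`⟨c†_p c_q c†_r c_s⟩ = det M (δ_{qr} ρ_{sp} + ρ_{qp} ρ_{sr} − ρ_{qr} ρ_{sp})`, `ρ = h_T M⁻¹ g_Tᴴ`.
[cite: GubernatisKawashimaWerner2016, §7.2.4 and App. I eq. (I.2)] [cite: AveryAvery2006, App. B eq. (B.19)]
[cite: RodriguezGuzmanEtAl2012, App. A] -/
theorem kernel_dGamma_dGamma_eq (g A B h : Matrix ι ι ℂ) {T : Finset ι} {k : ℕ} (hT : T.card = k)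
    (hM : IsUnit ((gᴴ * h).submatrix (T.orderEmbOfFin hT) (T.orderEmbOfFin hT)).det) :
    star ((Gamma g).col T) ⬝ᵥ (dGamma A *ᵥ (dGamma B *ᵥ (Gamma h).col T)) =
      ((gᴴ * h).submatrix (T.orderEmbOfFin hT) (T.orderEmbOfFin hT)).det *
        ((((gᴴ * h).submatrix (T.orderEmbOfFin hT) (T.orderEmbOfFin hT))⁻¹ *
              (gᴴ * (A * B * h)).submatrix (T.orderEmbOfFin hT) (T.orderEmbOfFin hT)).trace +
          (((gᴴ * h).submatrix (T.orderEmbOfFin hT) (T.orderEmbOfFin hT))⁻¹ *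
                (gᴴ * (A * h)).submatrix (T.orderEmbOfFin hT) (T.orderEmbOfFin hT)).trace *
            (((gᴴ * h).submatrix (T.orderEmbOfFin hT) (T.orderEmbOfFin hT))⁻¹ *
                (gᴴ * (B * h)).submatrix (T.orderEmbOfFin hT) (T.orderEmbOfFin hT)).trace -
          (((gᴴ * h).submatrix (T.orderEmbOfFin hT) (T.orderEmbOfFin hT))⁻¹ *
                (gᴴ * (A * h)).submatrix (T.orderEmbOfFin hT) (T.orderEmbOfFin hT) *
              (((gᴴ * h).submatrix (T.orderEmbOfFin hT) (T.orderEmbOfFin hT))⁻¹ *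
                (gᴴ * (B * h)).submatrix (T.orderEmbOfFin hT) (T.orderEmbOfFin hT))).trace) := by
  set M := (gᴴ * h).submatrix (T.orderEmbOfFin hT) (T.orderEmbOfFin hT) with hMdef
  set X := (gᴴ * (A * h)).submatrix (T.orderEmbOfFin hT) (T.orderEmbOfFin hT) with hX
  set Y := (gᴴ * (B * h)).submatrix (T.orderEmbOfFin hT) (T.orderEmbOfFin hT) with hY
  set Z := (gᴴ * (A * B * h)).submatrix (T.orderEmbOfFin hT) (T.orderEmbOfFin hT) with hZ
  rw [kernel_dGamma_dGamma_eq_det g A B h hT, ← hMdef, ← hX, ← hY, ← hZ, adjugate_eq_det_smul_inv hM,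
    smul_mul, trace_smul, smul_eq_mul]
  -- the two-column terms: `det M (P_{jj} Q_{j'j'} − Q_{jj'} P_{j'j})`, extended by `0` on the diagonal
  have hterm : ∀ j, ∑ j' ∈ univ.erase j, ((M.updateCol j (Y.col j)).updateCol j' (X.col j')).det =
      ∑ j', M.det * ((M⁻¹ * Y) j j * (M⁻¹ * X) j' j' - (M⁻¹ * X) j j' * (M⁻¹ * Y) j' j) := by
    intro j
    rw [← sum_erase univ (a := j) (by ring)]
    refine sum_congr rfl fun j' hj' => ?_
    rw [det_updateCol_updateCol hM (ne_of_mem_erase hj').symm, inv_mulVec_col_apply, inv_mulVec_col_apply,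
      inv_mulVec_col_apply, inv_mulVec_col_apply]
  simp_rw [hterm]
  have hdirect : ∑ j, ∑ j', (M⁻¹ * Y) j j * (M⁻¹ * X) j' j' = (M⁻¹ * Y).trace * (M⁻¹ * X).trace := by
    simp only [Matrix.trace, diag_apply, sum_mul_sum]
  have hexch : ∑ j, ∑ j', (M⁻¹ * X) j j' * (M⁻¹ * Y) j' j = (M⁻¹ * X * (M⁻¹ * Y)).trace := by
    simp only [Matrix.trace, diag_apply, Matrix.mul_apply]
  have hsplit : ∑ j, ∑ j', M.det * ((M⁻¹ * Y) j j * (M⁻¹ * X) j' j' - (M⁻¹ * X) j j' * (M⁻¹ * Y) j' j) =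
      M.det * ((M⁻¹ * Y).trace * (M⁻¹ * X).trace) - M.det * (M⁻¹ * X * (M⁻¹ * Y)).trace := by
    rw [← hdirect, ← hexch, mul_sum, mul_sum, ← sum_sub_distrib]
    refine sum_congr rfl fun j _ => ?_
    rw [mul_sum, mul_sum, ← sum_sub_distrib]
    refine sum_congr rfl fun j' _ => ?_
    ring
  rw [hsplit]
  ring

/-! ### §6. The Hubbard energy kernel between two Slater determinants -/

/-- The **overlap matrix** `M = (gᴴ h)[T,T]` of the orbitals `g e_t`, `h e_t` (`t ∈ T`, increasing enumeration),
`M_{ij} = ⟨g e_{t_i}, h e_{t_j}⟩` (`𝒳^{ik}` of Rodríguez-Guzmán et al.; `L R` of the zero-temperature determinant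
method). [cite: RodriguezGuzmanEtAl2012, App. A] [cite: GubernatisKawashimaWerner2016, App. I] -/
def overlapMatrix (g h : Matrix ι ι ℂ) (T : Finset ι) {k : ℕ} (hT : T.card = k) : Matrix (Fin k) (Fin k) ℂ :=
  (gᴴ * h).submatrix (T.orderEmbOfFin hT) (T.orderEmbOfFin hT)

/-- The **transition density matrix** `ρ = h_T M⁻¹ g_Tᴴ` of a pair of Slater determinants with invertible
overlap matrix (`h_T`, `g_T` the `ι × k` matrices of occupied orbitals): `⟨Φ_g, c†_p c_q Φ_h⟩ = det M · ρ_{qp}`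
(`transitionDensity_spec`). It is `ρ^{ki} = 𝒮𝒟^{k*}(𝒳^{ik})⁻¹𝒟^{iT}` of Rodríguez-Guzmán et al. and `1 − Gᵀ` of
the zero-temperature determinant method. [cite: RodriguezGuzmanEtAl2012, App. A]
[cite: GubernatisKawashimaWerner2016, App. I eq. (I.2)] -/
def transitionDensity (g h : Matrix ι ι ℂ) (T : Finset ι) {k : ℕ} (hT : T.card = k) : Matrix ι ι ℂ :=
  h.submatrix id (T.orderEmbOfFin hT) * (overlapMatrix g h T hT)⁻¹ * (g.submatrix id (T.orderEmbOfFin hT))ᴴ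

/-- Unfolding lemma for the overlap matrix `𝒳 = (gᴴ h)[T,T]`. [cite: RodriguezGuzmanEtAl2012, App. A] -/
theorem overlapMatrix_eq (g h : Matrix ι ι ℂ) (T : Finset ι) {k : ℕ} (hT : T.card = k) :
    overlapMatrix g h T hT = (gᴴ * h).submatrix (T.orderEmbOfFin hT) (T.orderEmbOfFin hT) := rfl

/-- Unfolding lemma for the transition density matrix `ρ = h_T M⁻¹ g_Tᴴ`. [cite: RodriguezGuzmanEtAl2012, App. A] -/
theorem transitionDensity_eq (g h : Matrix ι ι ℂ) (T : Finset ι) {k : ℕ} (hT : T.card = k) :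
    transitionDensity g h T hT =
      h.submatrix id (T.orderEmbOfFin hT) * (overlapMatrix g h T hT)⁻¹ *
        (g.submatrix id (T.orderEmbOfFin hT))ᴴ := rfl

/-- **Overlap rule** in this notation: `⟨Φ_g, Φ_h⟩ = det M`.
[cite: AveryAvery2006, App. B eq. (B.6)–(B.7)] [cite: GubernatisKawashimaWerner2016, App. H eq. (H.4)] -/
theorem overlap_eq_det_overlapMatrix (g h : Matrix ι ι ℂ) {T : Finset ι} {k : ℕ} (hT : T.card = k) :
    star ((Gamma g).col T) ⬝ᵥ ((Gamma h).col T) = (overlapMatrix g h T hT).det :=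
  star_col_Gamma_dotProduct_col_Gamma_eq_det g h hT hT

omit [LinearOrder ι] in
/-- Restricting a product `gᴴ X` to the occupied block factors through the orbital matrices:
`(gᴴ X)[T,T] = g_Tᴴ X_T`. [folklore] -/
private theorem submatrix_conjTranspose_mul (g X : Matrix ι ι ℂ) {k : ℕ} (e : Fin k → ι) :
    (gᴴ * X).submatrix e e = (g.submatrix id e)ᴴ * X.submatrix id e := by
  ext i j
  simp only [submatrix_apply, mul_apply, conjTranspose_apply, id_eq]

/-- The matrix-unit block is rank one: `(gᴴ E_{aa'} h)[T,T] = ū_a ⊗ v_{a'}` with `ū_a = conj(g_{a,T})`,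
`v_{a'} = h_{a',T}`. [folklore] -/
private theorem submatrix_conjTranspose_single_mul (g h : Matrix ι ι ℂ) {k : ℕ} (e : Fin k → ι) (a a' : ι) :
    (gᴴ * (Matrix.single a a' (1 : ℂ) * h)).submatrix e e =
      vecMulVec (fun i => star (g a (e i))) (fun j => h a' (e j)) := by
  ext i j
  rw [submatrix_apply, conjTranspose_mul_single_mul_apply, vecMulVec_apply]

/-- Entries of the transition density matrix as a bilinear form in the occupied rows:
`ρ_{a'a} = h_{a',T} · M⁻¹ conj(g_{a,T})` (the entry form `ρ^{ki}_{γσ',ασ} = Σ 𝒮 𝒟^{k*} [𝒳^{ik}]⁻¹ 𝒟^{i}` as printed).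
[cite: RodriguezGuzmanEtAl2012, App. A] -/
theorem transitionDensity_apply (g h : Matrix ι ι ℂ) {T : Finset ι} {k : ℕ} (hT : T.card = k) (a' a : ι) :
    transitionDensity g h T hT a' a =
      (fun j => h a' (T.orderEmbOfFin hT j)) ⬝ᵥ
        ((overlapMatrix g h T hT)⁻¹ *ᵥ fun i => star (g a (T.orderEmbOfFin hT i))) := by
  rw [transitionDensity_eq]
  simp only [mul_apply, submatrix_apply, conjTranspose_apply, id_eq, dotProduct, mulVec, sum_mul, mul_sum]
  rw [sum_comm]
  refine sum_congr rfl fun l _ => sum_congr rfl fun i _ => ?_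
  ring

/-- **The transition density matrix does its job**: `⟨Φ_g, c†_p c_q Φ_h⟩ = det M · ρ_{qp}` for an invertible
overlap matrix. [cite: GubernatisKawashimaWerner2016, App. I eq. (I.2)] [cite: RodriguezGuzmanEtAl2012, App. A] -/
theorem transitionDensity_spec (g h : Matrix ι ι ℂ) {T : Finset ι} {k : ℕ} (hT : T.card = k)
    (hM : IsUnit (overlapMatrix g h T hT).det) (p q : ι) :
    star ((Gamma g).col T) ⬝ᵥ ((creation p * annihilation q) *ᵥ (Gamma h).col T) =
      (overlapMatrix g h T hT).det * transitionDensity g h T hT q p := by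
  rw [kernel_creation_mul_annihilation_eq g h hT, ← overlapMatrix_eq, adjugate_eq_det_smul_inv hM,
    transitionDensity_eq, Matrix.mul_smul, Matrix.smul_mul, Matrix.smul_apply, smul_eq_mul]

/-- `tr(M⁻¹ (gᴴ A h)[T,T]) = tr(A ρ)`: the one-body rule in transition-density form. [folklore] -/
private theorem trace_inv_mul_submatrix_eq_trace_mul_transitionDensity (g A h : Matrix ι ι ℂ) {T : Finset ι}
    {k : ℕ} (hT : T.card = k) :
    ((overlapMatrix g h T hT)⁻¹ * (gᴴ * (A * h)).submatrix (T.orderEmbOfFin hT) (T.orderEmbOfFin hT)).trace =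
      (A * transitionDensity g h T hT).trace := by
  have hAh : (A * h).submatrix id (T.orderEmbOfFin hT) = A * h.submatrix id (T.orderEmbOfFin hT) := by
    ext i j; simp only [submatrix_apply, mul_apply, id_eq]
  rw [submatrix_conjTranspose_mul, hAh, transitionDensity_eq, ← Matrix.mul_assoc, trace_mul_cycle,
    ← Matrix.mul_assoc, ← Matrix.mul_assoc]

/-- **Löwdin's one-body rule, transition-density form**: `⟨Φ_g, dΓ(A) Φ_h⟩ = det M · tr(A ρ)`.
[cite: RodriguezGuzmanEtAl2012, App. A] [cite: GubernatisKawashimaWerner2016, §7.2.4] -/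
theorem kernel_dGamma_eq_det_mul_trace_transitionDensity (g A h : Matrix ι ι ℂ) {T : Finset ι} {k : ℕ}
    (hT : T.card = k) (hM : IsUnit (overlapMatrix g h T hT).det) :
    star ((Gamma g).col T) ⬝ᵥ (dGamma A *ᵥ (Gamma h).col T) =
      (overlapMatrix g h T hT).det * (A * transitionDensity g h T hT).trace := by
  rw [kernel_dGamma_eq_det_mul_trace_inv g A h hT hM, ← overlapMatrix_eq,
    trace_inv_mul_submatrix_eq_trace_mul_transitionDensity]

/-- A matrix-unit one-body term: `tr(M⁻¹ (gᴴ E_{pq} h)[T,T]) = ρ_{qp}`. [folklore] -/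
private theorem trace_inv_mul_submatrix_single (g h : Matrix ι ι ℂ) {T : Finset ι} {k : ℕ} (hT : T.card = k)
    (p q : ι) :
    ((overlapMatrix g h T hT)⁻¹ *
        (gᴴ * (Matrix.single p q (1 : ℂ) * h)).submatrix (T.orderEmbOfFin hT) (T.orderEmbOfFin hT)).trace =
      transitionDensity g h T hT q p := by
  rw [submatrix_conjTranspose_single_mul, mul_vecMulVec, trace_vecMulVec, transitionDensity_apply,
    dotProduct_comm]

/-- The exchange trace for two matrix units: `tr(M⁻¹X_{E_{pp'}} M⁻¹X_{E_{rr'}}) = ρ_{p'r} ρ_{r'p}`. [folklore] -/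
private theorem trace_inv_mul_single_mul_inv_mul_single (g h : Matrix ι ι ℂ) {T : Finset ι} {k : ℕ}
    (hT : T.card = k) (p p' r r' : ι) :
    ((overlapMatrix g h T hT)⁻¹ *
          (gᴴ * (Matrix.single p p' (1 : ℂ) * h)).submatrix (T.orderEmbOfFin hT) (T.orderEmbOfFin hT) *
        ((overlapMatrix g h T hT)⁻¹ *
          (gᴴ * (Matrix.single r r' (1 : ℂ) * h)).submatrix (T.orderEmbOfFin hT) (T.orderEmbOfFin hT))).trace =
      transitionDensity g h T hT p' r * transitionDensity g h T hT r' p := by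
  rw [submatrix_conjTranspose_single_mul, submatrix_conjTranspose_single_mul, mul_vecMulVec, mul_vecMulVec,
    vecMulVec_mul_vecMulVec, trace_vecMulVec, dotProduct_smul, transitionDensity_apply, transitionDensity_apply,
    smul_eq_mul, dotProduct_comm (fun j => h r' (T.orderEmbOfFin hT j))]

section Hubbard

variable {Λ : Type*} [LinearOrder Λ] [Fintype Λ] (G : SimpleGraph Λ) [DecidableRel G.Adj]

/-- The Hubbard Hamiltonian as one-body part plus interaction: `H = dΓ(K) + U Σ_x n_{x↑} n_{x↓}` with
`K = hubbardOneBody G t 0` the hopping matrix. [cite: BenfattoGiulianiMastropietro2006, §2.1] -/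
theorem hamiltonian_eq_dGamma_add (t U : ℝ) :
    hamiltonian G t U = dGamma (hubbardOneBody G t 0) + (U : ℂ) • ∑ x, numberOp x 0 * numberOp x 1 := by
  rw [← hamiltonianWith_zero_eq_dGamma, hamiltonianWith_zero]
  simp only [hamiltonian, Complex.ofReal_zero, zero_smul, add_zero]

/-- `n_{xσ} = dΓ(E_{(xσ)(xσ)})`. [folklore] -/
private theorem numberOp_eq_dGamma_single (x : Λ) (σ : Fin 2) :
    numberOp x σ = dGamma (Matrix.single (orb x σ) (orb x σ) (1 : ℂ)) := by
  rw [dGamma_single, one_smul, numberOp]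

omit [LinearOrder Λ] [Fintype Λ] in
/-- The two spin orbitals of a site are distinct. [folklore] -/
private theorem orb_zero_ne_one (x : Λ) : orb x 0 ≠ orb x 1 := by
  intro h
  have h2 := congrArg (fun o : Orb Λ => (ofLex o).2) h
  simp at h2

/-- **The Hubbard energy kernel between two non-orthogonal Slater determinants** (the formula evaluated,
in exact arithmetic, by symmetry-projected determinant certificates): for `Φ_g = Γ(g)|T⟩`, `Φ_h = Γ(h)|T⟩`
with invertible overlap matrix `M` and transition density matrix `ρ = h_T M⁻¹ g_Tᴴ`,
`⟨Φ_g, H Φ_h⟩ = det M · ( tr(K ρ) + U Σ_x (ρ_{x↑,x↑} ρ_{x↓,x↓} − ρ_{x↑,x↓} ρ_{x↓,x↑}) )`,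
`K` the hopping matrix — overlap times (one-body contraction + Hartree − Fock terms of the generalized
Wick theorem). Rodríguez-Guzmán et al. App. A: `𝓗 = h · n`, `n = det 𝒳`, `h = ½ t + ½ Tr(Γ ρ)`.
[cite: RodriguezGuzmanEtAl2012, App. A] [cite: GubernatisKawashimaWerner2016, §7.2.4]
[cite: AveryAvery2006, App. B eqs. (B.14), (B.19)] -/
theorem hubbard_kernel_eq (g h : Matrix (Orb Λ) (Orb Λ) ℂ) {T : Finset (Orb Λ)} {k : ℕ} (hT : T.card = k)
    (hM : IsUnit (overlapMatrix g h T hT).det) (t U : ℝ) :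
    star ((Gamma g).col T) ⬝ᵥ (hamiltonian G t U *ᵥ (Gamma h).col T) =
      (overlapMatrix g h T hT).det *
        ((hubbardOneBody G t 0 * transitionDensity g h T hT).trace +
          U * ∑ x, (transitionDensity g h T hT (orb x 0) (orb x 0) * transitionDensity g h T hT (orb x 1) (orb x 1) -
            transitionDensity g h T hT (orb x 0) (orb x 1) * transitionDensity g h T hT (orb x 1) (orb x 0))) := by
  have hM' : IsUnit ((gᴴ * h).submatrix (T.orderEmbOfFin hT) (T.orderEmbOfFin hT)).det := hM
  -- the interaction term, site by site: contraction `E_{x↑}E_{x↓} = 0`, Hartree `ρ↑↑ρ↓↓`, Fock `ρ↑↓ρ↓↑`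
  have hx : ∀ x : Λ, star ((Gamma g).col T) ⬝ᵥ ((numberOp x 0 * numberOp x 1) *ᵥ (Gamma h).col T) =
      (overlapMatrix g h T hT).det *
        (transitionDensity g h T hT (orb x 0) (orb x 0) * transitionDensity g h T hT (orb x 1) (orb x 1) -
          transitionDensity g h T hT (orb x 0) (orb x 1) * transitionDensity g h T hT (orb x 1) (orb x 0)) := by
    intro x
    rw [numberOp_eq_dGamma_single, numberOp_eq_dGamma_single, ← mulVec_mulVec,
      kernel_dGamma_dGamma_eq g _ _ h hT hM', ← overlapMatrix_eq,
      Matrix.single_mul_single_of_ne (h := orb_zero_ne_one x), Matrix.zero_mul, Matrix.mul_zero]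
    simp only [submatrix_zero, Pi.zero_apply, Matrix.mul_zero, trace_zero, zero_add]
    rw [trace_inv_mul_submatrix_single, trace_inv_mul_submatrix_single, trace_inv_mul_single_mul_inv_mul_single]
  rw [hamiltonian_eq_dGamma_add, add_mulVec, dotProduct_add,
    kernel_dGamma_eq_det_mul_trace_transitionDensity g _ h hT hM, smul_mulVec, dotProduct_smul,
    sum_mulVec, dotProduct_sum, smul_eq_mul]
  simp_rw [hx]
  rw [← mul_sum]
  ring

/-- With a one-body symmetry operator `Γ(u)` inserted (lattice permutation, spin rotation, …) the kernels
are those of the transformed determinant: `⟨Φ_g, H Γ(u) Φ_h⟩ = ⟨Φ_g, H Φ_{u h}⟩`.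
[cite: RodriguezGuzmanEtAl2012, App. A] -/
theorem hubbard_kernel_Gamma_mulVec (g u h : Matrix (Orb Λ) (Orb Λ) ℂ) (T : Finset (Orb Λ)) (t U : ℝ) :
    star ((Gamma g).col T) ⬝ᵥ (hamiltonian G t U *ᵥ (Gamma u *ᵥ (Gamma h).col T)) =
      star ((Gamma g).col T) ⬝ᵥ (hamiltonian G t U *ᵥ (Gamma (u * h)).col T) := by
  rw [Gamma_mulVec_col_Gamma]

end Hubbard

end SlaterKernel

end Literature.MathematicalPhysics.QuantumLattice
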